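import Mathlib
import HarnessLib
import Summits.Ventures.LatticeQCDFlow.Scaling.AutoregressiveGaugeHeatBathVolumeFloor
import Summits.Ventures.LatticeQCDFlow.Scaling.PlaquettePeelingClosingMap
import Summits.Ventures.LatticeQCDFlow.Scaling.TorusClosingSection

/-!
# LatticeQCDFlow / Scaling — the volume-law floor with EVERY uncovered plaquette paying: for an optimal
# structure the closing map is total, `Z/Z_B ≤ ∏_{a∈B} c_{n_a+1}/c` with `Σ_a n_a = k_min`, and the
# exact sampler's acceptance mass is `≤ (∏_a θ_a)·M^k/F_R(U)`, `θ_a = c_{n_a+1}/(c·M^{n_a}) ≤ 1`, `< 1` if `n_a ≥ 1`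

HONEST FRAMING: exact (Metropolis-corrected) sampling algorithms for lattice gauge theory;
figures of merit are autocorrelation/cost numbers at stated couplings and volumes; no
continuum-physics claim.

Venture `LatticeQCDFlow` (cell pub-lqcd), topic `Scaling`, FANOUT row 30 (lean-1, GEN-27) — OUR WORK on
THEORY-2.md §4 row C5, the LOWER half of the volume law, sharpened.  GEN-26
(`AutoregressiveGaugeHeatBathVolumeFloor` ∕ `…VolumeLaw`) charged one factor `M₂/M < 1` per closer of an
injective closing SECTION (`s` of them, `(2d−3)s ≥ k_min`).  With the closing MAP of
`PlaquettePeelingClosingMap` (this generation) nothing is thinned out: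

* §1 **`exists_closingMap_of_optimal`** — in an OPTIMAL ranked structure (`#Bᶜ = k_min(d, L)`) every uncovered
  plaquette carries a covered top link (`TorusClosingSection.exists_topLink_mem_of_optimal`), so after refining
  the rank to an injective one the maximal-rank closer `u p'` is defined for EVERY `p' ∉ B`: a total closing
  map;
* §2 **`integral_prod_weight_div_le_of_totalClosingMap`** — `Z/Z_B ≤ ∏_{a∈B} c_{n_a+1}/c` for a total closing
  map (`n_a = #u⁻¹(a)`, `Σ_a n_a = k`), i.e. `Z/Z_B ≤ (∏_a θ_a)·M^k` with `θ_a = c_{n_a+1}/(c M^{n_a})`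
  (**`prod_ratio_eq`**);
* §3 **`totalClosingMap_volumeFloor`** — the exact sampler (independence Metropolis with the block proposal
  `q_B`, target `π`): acceptance mass from `U` is `≤ (∏_a θ_a)·M^k/F_R(U)`, and every event
  `A ⊆ {F_R > θM^k}` of positive probability has `τ_int(1_A − π(A)) ≥ 1/(π(A) + (∏_a θ_a)/θ) − 1/2`
  (the route of GEN-26's `closing_volumeFloor` with the sharper constant) — for an optimal structure apply it
  to the total closing map of §1.  Each `θ_a ≤ 1`, and `θ_a < 1` as soon as `n_a ≥ 1` and `w` is not constant
  (`PlaquetteManyWeightConstant.integral_pow_lt`); since `Σ_a n_a = k_min`, EVERY uncovered plaquette now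
  sits in some fibre and lowers the floor's base — against GEN-26's `(M₂/M)^s` with only `s ≥ k_min/(2d−3)`
  factors guaranteed.

No `def`, no `sorry`, nothing cited as a fact beyond the tree.
-/

noncomputable section

namespace Summit.Ventures.LatticeQCDFlow.Theory2.Autoregressive

open MeasureTheory ProbabilityTheory Function Finset
open scoped ENNReal
open Literature.MathematicalPhysics.QuantumFieldTheory Literature.MathematicalPhysics.QuantumLattice
open Summit.Ventures.LatticeQCDFlow.Exactness Summit.Ventures.LatticeQCDFlow.Scoring

variable {d L : ℕ} [NeZero L]

/-! ## §1 Optimal structures have a total closing map -/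

/-- **In an optimal ranked structure the maximal-rank closer is defined on EVERY uncovered plaquette.**
`L ≥ 2`; `(B, t, rank)` ranked with `#Bᶜ = k_min(d, L) = (d−1)(d−2)/2·L^d + (d−1)`.  There are a refined rank
`rank'` (still ranking `(B, t)`) and `u : Bᶜ → B` with `t (u p')` a link of `p'` and `rank' p < rank' (u p')` for
every other covered `p` whose top link lies on `p'`. [ours] -/
theorem exists_closingMap_of_optimal (hL : 2 ≤ L) (B : Finset (Plaquette d L)) (t : Plaquette d L → Edge d L)
    (ht : ∀ p ∈ B, t p ∈ ({(p.1, p.2.1.1), (p.1.shift p.2.1.1, p.2.1.2),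
        (p.1.shift p.2.1.2, p.2.1.1), (p.1, p.2.1.2)} : Finset (Edge d L)))
    (rank : Plaquette d L → ℕ)
    (hrank : ∀ p ∈ B, ∀ p' ∈ B, p ≠ p' → t p ∈ ({(p'.1, p'.2.1.1), (p'.1.shift p'.2.1.1, p'.2.1.2),
        (p'.1.shift p'.2.1.2, p'.2.1.1), (p'.1, p'.2.1.2)} : Finset (Edge d L)) → rank p < rank p')
    (hopt : (Finset.univ \ B).card = (d - 1) * (d - 2) / 2 * L ^ d + (d - 1)) :
    ∃ (rank' : Plaquette d L → ℕ) (u : Plaquette d L → Plaquette d L),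
      (∀ p ∈ B, ∀ p' ∈ B, p ≠ p' → t p ∈ ({(p'.1, p'.2.1.1), (p'.1.shift p'.2.1.1, p'.2.1.2),
        (p'.1.shift p'.2.1.2, p'.2.1.1), (p'.1, p'.2.1.2)} : Finset (Edge d L)) → rank' p < rank' p') ∧
      (∀ p' ∈ Finset.univ \ B, u p' ∈ B) ∧
      (∀ p' ∈ Finset.univ \ B, t (u p') ∈ ({(p'.1, p'.2.1.1), (p'.1.shift p'.2.1.1, p'.2.1.2),
        (p'.1.shift p'.2.1.2, p'.2.1.1), (p'.1, p'.2.1.2)} : Finset (Edge d L))) ∧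
      (∀ p' ∈ Finset.univ \ B, ∀ p ∈ B, p ≠ u p' → t p ∈ ({(p'.1, p'.2.1.1), (p'.1.shift p'.2.1.1, p'.2.1.2),
        (p'.1.shift p'.2.1.2, p'.2.1.1), (p'.1, p'.2.1.2)} : Finset (Edge d L)) → rank' p < rank' (u p')) := by
  classical
  obtain ⟨rank', hinj', hrank'⟩ := exists_injective_rank B t rank hrank
  -- the closers of `p'`: covered plaquettes whose top link lies on `p'` (non-empty by optimality)
  have hC : ∀ p' : Plaquette d L, ∃ q : Plaquette d L, p' ∉ B →
      (q ∈ B ∧ t q ∈ ({(p'.1, p'.2.1.1), (p'.1.shift p'.2.1.1, p'.2.1.2),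
        (p'.1.shift p'.2.1.2, p'.2.1.1), (p'.1, p'.2.1.2)} : Finset (Edge d L)) ∧
        ∀ p ∈ B, t p ∈ ({(p'.1, p'.2.1.1), (p'.1.shift p'.2.1.1, p'.2.1.2),
        (p'.1.shift p'.2.1.2, p'.2.1.1), (p'.1, p'.2.1.2)} : Finset (Edge d L)) → rank' p ≤ rank' q) := by
    intro p'
    by_cases hp' : p' ∈ B
    · exact ⟨p', fun h => absurd hp' h⟩
    · set C : Finset (Plaquette d L) := B.filter (fun p => t p ∈ ({(p'.1, p'.2.1.1), (p'.1.shift p'.2.1.1, p'.2.1.2),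
        (p'.1.shift p'.2.1.2, p'.2.1.1), (p'.1, p'.2.1.2)} : Finset (Edge d L))) with hCdef
      have hCne : C.Nonempty := by
        obtain ⟨p, hp, hmem⟩ := exists_topLink_mem_of_optimal hL B t ht rank hrank hopt hp'
        exact ⟨p, Finset.mem_filter.2 ⟨hp, hmem⟩⟩
      obtain ⟨q, hqC, hqmax⟩ := C.exists_max_image rank' hCne
      have hq := Finset.mem_filter.1 hqC
      exact ⟨q, fun _ => ⟨hq.1, hq.2, fun p hp hmem => hqmax p (Finset.mem_filter.2 ⟨hp, hmem⟩)⟩⟩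
  choose u hu using hC
  refine ⟨rank', u, hrank', fun p' hp' => (hu p' (Finset.mem_sdiff.1 hp').2).1,
    fun p' hp' => (hu p' (Finset.mem_sdiff.1 hp').2).2.1, fun p' hp' p hp hne hmem => ?_⟩
  have h := (hu p' (Finset.mem_sdiff.1 hp').2).2.2 p hp hmem
  exact lt_of_le_of_ne h fun heq => hne (hinj' heq)

/-! ## §2 `Z/Z_B` with a total closing map -/

section Haar

variable {G : Type*} [Group G] [TopologicalSpace G] [IsTopologicalGroup G]
  [CompactSpace G] [SecondCountableTopology G] [MeasurableSpace G] [BorelSpace G]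

omit [SecondCountableTopology G] in
/-- Bookkeeping: `∏_{a∈B} c_{n_a+1}/c = (∏_{a∈B} c_{n_a+1}/(c·M^{n_a})) · M^k` for a total closing map
(`Σ_{a∈B} n_a = k = #Bᶜ`, the fibres partition `Bᶜ`). [ours] -/
theorem prod_ratio_eq {w : G → ℝ} {M : ℝ} (hM : 0 < M) (B : Finset (Plaquette d L))
    (u : Plaquette d L → Plaquette d L) (huB : ∀ p' ∈ Finset.univ \ B, u p' ∈ B) :
    ∏ a ∈ B, (∫ h, w h ^ (((Finset.univ \ B).filter (fun p' => u p' = a)).card + 1) ∂(haarProbability G)) /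
        ∫ g, w g ∂(haarProbability G) =
      (∏ a ∈ B, (∫ h, w h ^ (((Finset.univ \ B).filter (fun p' => u p' = a)).card + 1) ∂(haarProbability G)) /
          ((∫ g, w g ∂(haarProbability G)) * M ^ ((Finset.univ \ B).filter (fun p' => u p' = a)).card)) *
        M ^ (Finset.univ \ B).card := by
  classical
  have hk : (Finset.univ \ B).card = ∑ a ∈ B, ((Finset.univ \ B).filter (fun p' => u p' = a)).card :=
    Finset.card_eq_sum_card_fiberwise fun p' hp' => huB p' hp'
  rw [hk, ← Finset.prod_pow_eq_pow_sum, ← Finset.prod_mul_distrib]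
  refine Finset.prod_congr rfl fun a _ => ?_
  have hMn : M ^ ((Finset.univ \ B).filter (fun p' => u p' = a)).card ≠ 0 := pow_ne_zero _ hM.ne'
  rw [div_mul_eq_mul_div, mul_comm (∫ g, w g ∂(haarProbability G)), ← div_div, mul_div_cancel_right₀ _ hMn]

/-- **`Z/Z_B ≤ (∏_{a∈B} θ_a)·M^k` for a TOTAL closing map**, `θ_a = c_{n_a+1}/(c·M^{n_a})`
(`PlaquettePeelingClosingMap.integral_prod_weight_div_le_of_closingMap` with `S = Bᶜ`). [ours] -/
theorem integral_prod_weight_div_le_of_totalClosingMap (hL : 2 ≤ L) {w : G → ℝ} (hw : Continuous w)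
    {m M : ℝ} (hm0 : 0 < m) (hm : ∀ g, m ≤ w g) (hM : ∀ g, w g ≤ M)
    (B : Finset (Plaquette d L)) (t : Plaquette d L → Edge d L)
    (ht : ∀ p ∈ B, t p ∈ ({(p.1, p.2.1.1), (p.1.shift p.2.1.1, p.2.1.2),
        (p.1.shift p.2.1.2, p.2.1.1), (p.1, p.2.1.2)} : Finset (Edge d L)))
    (rank : Plaquette d L → ℕ)
    (hrank : ∀ p ∈ B, ∀ p' ∈ B, p ≠ p' → t p ∈ ({(p'.1, p'.2.1.1), (p'.1.shift p'.2.1.1, p'.2.1.2),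
        (p'.1.shift p'.2.1.2, p'.2.1.1), (p'.1, p'.2.1.2)} : Finset (Edge d L)) → rank p < rank p')
    (u : Plaquette d L → Plaquette d L)
    (huB : ∀ p' ∈ Finset.univ \ B, u p' ∈ B)
    (hut : ∀ p' ∈ Finset.univ \ B, t (u p') ∈ ({(p'.1, p'.2.1.1), (p'.1.shift p'.2.1.1, p'.2.1.2),
        (p'.1.shift p'.2.1.2, p'.2.1.1), (p'.1, p'.2.1.2)} : Finset (Edge d L)))
    (humax : ∀ p' ∈ Finset.univ \ B, ∀ p ∈ B, p ≠ u p' → t p ∈ ({(p'.1, p'.2.1.1), (p'.1.shift p'.2.1.1, p'.2.1.2),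
        (p'.1.shift p'.2.1.2, p'.2.1.1), (p'.1, p'.2.1.2)} : Finset (Edge d L)) → rank p < rank (u p')) :
    (∫ U, ∏ p : Plaquette d L, w (plaquetteHolonomy U p.1 p.2.1.1 p.2.1.2) ∂(Measure.pi fun _ : Edge d L => haarProbability G)) /
      (∫ U, ∏ p ∈ B, w (plaquetteHolonomy U p.1 p.2.1.1 p.2.1.2) ∂(Measure.pi fun _ : Edge d L => haarProbability G)) ≤
      (∏ a ∈ B, (∫ h, w h ^ (((Finset.univ \ B).filter (fun p' => u p' = a)).card + 1) ∂(haarProbability G)) /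
          ((∫ g, w g ∂(haarProbability G)) * M ^ ((Finset.univ \ B).filter (fun p' => u p' = a)).card)) *
        M ^ (Finset.univ \ B).card := by
  have hw0 : ∀ g, 0 < w g := fun g => hm0.trans_le (hm g)
  have hMpos : 0 < M := (hw0 1).trans_le (hM 1)
  have h := integral_prod_weight_div_le_of_closingMap (G := G) hL hw hm0 hm hM B t ht rank hrank
    (Finset.univ \ B) u (fun p' hp' => (Finset.mem_sdiff.1 hp').2) huB hut humax
  rw [Nat.sub_self, pow_zero, one_mul] at h
  exact h.trans (le_of_eq (prod_ratio_eq hMpos B u huB))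

omit [SecondCountableTopology G] in
/-- Each factor `θ_a = c_{n_a+1}/(c·M^{n_a})` is at most `1` (`0 ≤ w ≤ M`). [ours] -/
theorem ratio_le_one {w : G → ℝ} (hw : Continuous w) (hw0 : ∀ g, 0 < w g) {M : ℝ} (hM : ∀ g, w g ≤ M) (n : ℕ) :
    (∫ h, w h ^ (n + 1) ∂(haarProbability G)) / ((∫ g, w g ∂(haarProbability G)) * M ^ n) ≤ 1 := by
  have hc : 0 < ∫ g, w g ∂(haarProbability G) := haarProbability_integral_pos_of_continuous_pos hw hw0
  have hMpos : 0 < M := (hw0 1).trans_le (hM 1)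
  rw [div_le_one (mul_pos hc (pow_pos hMpos _)), mul_comm]
  exact integral_pow_le hw (fun g => (hw0 g).le) hM n

omit [SecondCountableTopology G] in
/-- … and STRICTLY below `1` when `n ≥ 1` and `w` is not constant. [ours] -/
theorem ratio_lt_one {w : G → ℝ} (hw : Continuous w) (hw0 : ∀ g, 0 < w g) {M : ℝ} (hM : ∀ g, w g ≤ M)
    {g₀ : G} (hg₀ : w g₀ < M) (n : ℕ) :
    (∫ h, w h ^ (n + 2) ∂(haarProbability G)) / ((∫ g, w g ∂(haarProbability G)) * M ^ (n + 1)) < 1 := by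
  have hc : 0 < ∫ g, w g ∂(haarProbability G) := haarProbability_integral_pos_of_continuous_pos hw hw0
  have hMpos : 0 < M := (hw0 1).trans_le (hM 1)
  rw [div_lt_one (mul_pos hc (pow_pos hMpos _)), mul_comm]
  exact integral_pow_lt hw hw0 hM hg₀ n

end Haar

/-! ## §3 The floor with every uncovered plaquette paying -/

section Floor

variable {G : Type*} [Group G] [TopologicalSpace G] [IsTopologicalGroup G]
  [CompactSpace G] [SecondCountableTopology G] [MeasurableSpace G] [BorelSpace G]

/-- **THE VOLUME-LAW FLOOR WITH A TOTAL CLOSING MAP.**  `L ≥ 2`; `w` continuous, `0 < m ≤ w ≤ M`;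
`(B, t, rank)` ranked; `u : Bᶜ → B` a total closing map (`t (u p')` a link of `p'`, `u p'` of larger rank than
every other covered plaquette whose top link lies on `p'`); `π` the plaquette-weight target, `q` the block
proposal.  With `η := ∏_{a∈B} c_{n_a+1}/(c·M^{n_a})` (`n_a = #u⁻¹(a)`): (a) the exact sampler's acceptance mass
from `U` is `≤ η·M^k/F_R(U)`; (b) every event `A ⊆ {F_R > θM^k}` of positive probability has
`τ_int(1_A − π(A)) ≥ 1/(π(A) + η/θ) − 1/2`.  (GEN-26's `closing_volumeFloor` with `(M₂/M)^s` replaced by `η`;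
same route through `Scoring.indepMH_event_tauInt_ge`.) [ours] -/
theorem totalClosingMap_volumeFloor (hL : 2 ≤ L) {w : G → ℝ} (hw : Continuous w) {m M : ℝ} (hm0 : 0 < m)
    (hm : ∀ g, m ≤ w g) (hM : ∀ g, w g ≤ M)
    (B : Finset (Plaquette d L)) (t : Plaquette d L → Edge d L)
    (ht : ∀ p ∈ B, t p ∈ ({(p.1, p.2.1.1), (p.1.shift p.2.1.1, p.2.1.2),
        (p.1.shift p.2.1.2, p.2.1.1), (p.1, p.2.1.2)} : Finset (Edge d L)))
    (rank : Plaquette d L → ℕ)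
    (hrank : ∀ p ∈ B, ∀ p' ∈ B, p ≠ p' → t p ∈ ({(p'.1, p'.2.1.1), (p'.1.shift p'.2.1.1, p'.2.1.2),
        (p'.1.shift p'.2.1.2, p'.2.1.1), (p'.1, p'.2.1.2)} : Finset (Edge d L)) → rank p < rank p')
    (u : Plaquette d L → Plaquette d L)
    (huB : ∀ p' ∈ Finset.univ \ B, u p' ∈ B)
    (hut : ∀ p' ∈ Finset.univ \ B, t (u p') ∈ ({(p'.1, p'.2.1.1), (p'.1.shift p'.2.1.1, p'.2.1.2),
        (p'.1.shift p'.2.1.2, p'.2.1.1), (p'.1, p'.2.1.2)} : Finset (Edge d L)))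
    (humax : ∀ p' ∈ Finset.univ \ B, ∀ p ∈ B, p ≠ u p' → t p ∈ ({(p'.1, p'.2.1.1), (p'.1.shift p'.2.1.1, p'.2.1.2),
        (p'.1.shift p'.2.1.2, p'.2.1.1), (p'.1, p'.2.1.2)} : Finset (Edge d L)) → rank p < rank (u p'))
    (π q : Measure (GaugeConfig d L G)) [IsProbabilityMeasure π] [IsProbabilityMeasure q]
    (hπ : π = (Measure.pi fun _ : Edge d L => haarProbability G).withDensity fun U =>
      ENNReal.ofReal ((∏ p : Plaquette d L, w (plaquetteHolonomy U p.1 p.2.1.1 p.2.1.2)) /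
        ∫ V, ∏ p : Plaquette d L, w (plaquetteHolonomy V p.1 p.2.1.1 p.2.1.2)
          ∂(Measure.pi fun _ : Edge d L => haarProbability G)))
    (hq : q = (Measure.pi fun _ : Edge d L => haarProbability G).withDensity fun U =>
      ENNReal.ofReal ((∏ p ∈ B, w (plaquetteHolonomy U p.1 p.2.1.1 p.2.1.2)) /
        ∫ V, ∏ p ∈ B, w (plaquetteHolonomy V p.1 p.2.1.1 p.2.1.2)
          ∂(Measure.pi fun _ : Edge d L => haarProbability G))) :
    (∀ U : GaugeConfig d L G,
      (imhAcceptMass q (fun U =>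
        ((∫ V, ∏ p : Plaquette d L, w (plaquetteHolonomy V p.1 p.2.1.1 p.2.1.2)
            ∂(Measure.pi fun _ : Edge d L => haarProbability G)) /
          ((∫ V, ∏ p ∈ B, w (plaquetteHolonomy V p.1 p.2.1.1 p.2.1.2)
            ∂(Measure.pi fun _ : Edge d L => haarProbability G)) *
            ∏ p ∈ Finset.univ \ B, w (plaquetteHolonomy U p.1 p.2.1.1 p.2.1.2)))⁻¹) U).toReal ≤
        (∏ a ∈ B, (∫ h, w h ^ (((Finset.univ \ B).filter (fun p' => u p' = a)).card + 1) ∂(haarProbability G)) /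
          ((∫ g, w g ∂(haarProbability G)) * M ^ ((Finset.univ \ B).filter (fun p' => u p' = a)).card)) * (M ^ (Finset.univ \ B).card /
          ∏ p ∈ Finset.univ \ B, w (plaquetteHolonomy U p.1 p.2.1.1 p.2.1.2))) ∧
    ∀ θ : ℝ, 0 < θ → ∀ A : Set (GaugeConfig d L G), MeasurableSet A →
      (∀ U ∈ A, θ * M ^ (Finset.univ \ B).card <
        ∏ p ∈ Finset.univ \ B, w (plaquetteHolonomy U p.1 p.2.1.1 p.2.1.2)) → 0 < π.real A →
      1 / (π.real A + (∏ a ∈ B, (∫ h, w h ^ (((Finset.univ \ B).filter (fun p' => u p' = a)).card + 1) ∂(haarProbability G)) /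
          ((∫ g, w g ∂(haarProbability G)) * M ^ ((Finset.univ \ B).filter (fun p' => u p' = a)).card)) / θ) - 1 / 2 ≤
        tauInt (fun n => autocov (indepMH q fun U =>
          ((∫ V, ∏ p : Plaquette d L, w (plaquetteHolonomy V p.1 p.2.1.1 p.2.1.2)
              ∂(Measure.pi fun _ : Edge d L => haarProbability G)) /
            ((∫ V, ∏ p ∈ B, w (plaquetteHolonomy V p.1 p.2.1.1 p.2.1.2)
              ∂(Measure.pi fun _ : Edge d L => haarProbability G)) *
              ∏ p ∈ Finset.univ \ B, w (plaquetteHolonomy U p.1 p.2.1.1 p.2.1.2)))⁻¹) π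
            (fun U => A.indicator (fun _ => (1 : ℝ)) U - π.real A) n /
          autocov (indepMH q fun U =>
          ((∫ V, ∏ p : Plaquette d L, w (plaquetteHolonomy V p.1 p.2.1.1 p.2.1.2)
              ∂(Measure.pi fun _ : Edge d L => haarProbability G)) /
            ((∫ V, ∏ p ∈ B, w (plaquetteHolonomy V p.1 p.2.1.1 p.2.1.2)
              ∂(Measure.pi fun _ : Edge d L => haarProbability G)) *
              ∏ p ∈ Finset.univ \ B, w (plaquetteHolonomy U p.1 p.2.1.1 p.2.1.2)))⁻¹) π
            (fun U => A.indicator (fun _ => (1 : ℝ)) U - π.real A) 0) := by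
  set Haar : Measure (GaugeConfig d L G) := Measure.pi fun _ : Edge d L => haarProbability G with hHaar
  set FT : GaugeConfig d L G → ℝ := fun U => ∏ p : Plaquette d L, w (plaquetteHolonomy U p.1 p.2.1.1 p.2.1.2)
    with hFT
  set FB : GaugeConfig d L G → ℝ := fun U => ∏ p ∈ B, w (plaquetteHolonomy U p.1 p.2.1.1 p.2.1.2) with hFB
  set FR : GaugeConfig d L G → ℝ := fun U => ∏ p ∈ Finset.univ \ B, w (plaquetteHolonomy U p.1 p.2.1.1 p.2.1.2)
    with hFR
  set ZT : ℝ := ∫ V, FT V ∂Haar with hZT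
  set ZB : ℝ := ∫ V, FB V ∂Haar with hZB
  set k : ℕ := (Finset.univ \ B).card with hk
  set η : ℝ := (∏ a ∈ B, (∫ h, w h ^ (((Finset.univ \ B).filter (fun p' => u p' = a)).card + 1) ∂(haarProbability G)) /
          ((∫ g, w g ∂(haarProbability G)) * M ^ ((Finset.univ \ B).filter (fun p' => u p' = a)).card)) with hηdef
  have hw0 : ∀ g, 0 < w g := fun g => hm0.trans_le (hm g)
  have hMpos : 0 < M := (hw0 1).trans_le (hM 1)
  haveI : IsProbabilityMeasure Haar := by rw [hHaar]; infer_instance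
  have hc : 0 < ∫ g, w g ∂(haarProbability G) := haarProbability_integral_pos_of_continuous_pos hw hw0
  have hFTc : Continuous FT := continuous_prodPlaquetteWeight_anyDim hw Finset.univ
  have hFRc : Continuous FR := continuous_prodPlaquetteWeight_anyDim hw (Finset.univ \ B)
  have hFTpos : ∀ U, 0 < FT U := fun U => prod_pos fun p _ => hw0 _
  have hFRpos : ∀ U, 0 < FR U := fun U => prod_pos fun p _ => hw0 _
  have hFRle : ∀ U, FR U ≤ M ^ k := fun U => (pow_le_prodPlaquetteWeight_le_pow_anyDim hm0 hm hM _ U).2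
  have hFTi : Integrable FT Haar := by
    refine Integrable.mono' (integrable_const (M ^ (Finset.univ : Finset (Plaquette d L)).card))
      hFTc.aestronglyMeasurable (ae_of_all _ fun U => ?_)
    rw [Real.norm_eq_abs, abs_of_pos (hFTpos U)]
    exact (pow_le_prodPlaquetteWeight_le_pow_anyDim hm0 hm hM _ U).2
  have hZTpos : 0 < ZT := by
    have h := integral_mono (integrable_const (m ^ (Finset.univ : Finset (Plaquette d L)).card)) hFTi
      fun U => (pow_le_prodPlaquetteWeight_le_pow_anyDim hm0 hm hM _ U).1
    rw [integral_const, smul_eq_mul, probReal_univ, one_mul] at h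
    exact lt_of_lt_of_le (pow_pos hm0 _) h
  have hZB : ZB = (∫ g, w g ∂(haarProbability G)) ^ B.card :=
    integral_prod_weight_eq_pow_of_rank (G := G) hL hw hm0 hm hM B t ht rank hrank
  have hZBpos : 0 < ZB := by rw [hZB]; exact pow_pos hc _
  -- the total-closing-map bound `Z/Z_B ≤ η·M^k`
  have hdiv : ZT / ZB ≤ η * M ^ k :=
    integral_prod_weight_div_le_of_totalClosingMap (G := G) hL hw hm0 hm hM B t ht rank hrank u huB hut humax
  have hη0 : 0 ≤ η := by
    rw [hηdef]
    exact Finset.prod_nonneg fun a _ => div_nonneg (integral_nonneg fun h => pow_nonneg (hw0 h).le _)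
      (mul_nonneg hc.le (pow_nonneg hMpos.le _))
  -- the density ratio `ρ = Z/(Z_B F_R)` and the kernel weight `ρ⁻¹`
  set ρ : GaugeConfig d L G → ℝ := fun U => ZT / (ZB * FR U) with hρ
  have hρpos : ∀ U, 0 < ρ U := fun U => div_pos hZTpos (mul_pos hZBpos (hFRpos U))
  have hρm : Measurable ρ := (continuous_const.div (continuous_const.mul hFRc)
    fun U => (mul_pos hZBpos (hFRpos U)).ne').measurable
  have hρle : ∀ U, ρ U ≤ η * (M ^ k / FR U) := by
    intro U
    calc ρ U = (ZT / ZB) / FR U := by rw [hρ, div_div]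
      _ ≤ (η * M ^ k) / FR U := div_le_div_of_nonneg_right hdiv (hFRpos U).le
      _ = η * (M ^ k / FR U) := mul_div_assoc _ _ _
  have hsplit : ∀ U, FT U = FR U * FB U := fun U => (Finset.prod_sdiff (Finset.subset_univ B)).symm
  have hFBpos : ∀ U, 0 < FB U := fun U => prod_pos fun p _ => hw0 _
  have hρq : q = π.withDensity fun U => ENNReal.ofReal (ρ U) := by
    rw [hq, hπ]
    change Haar.withDensity (fun U => ENNReal.ofReal (FB U / ZB)) =
      (Haar.withDensity fun U => ENNReal.ofReal (FT U / ZT)).withDensity fun U => ENNReal.ofReal (ρ U)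
    rw [← withDensity_mul _ (by fun_prop : Measurable fun U => ENNReal.ofReal (FT U / ZT))
      (by exact hρm.ennreal_ofReal)]
    refine withDensity_congr_ae (ae_of_all _ fun U => ?_)
    simp only [Pi.mul_apply]
    rw [← ENNReal.ofReal_mul (div_nonneg (hFTpos U).le hZTpos.le)]
    congr 1
    rw [hρ, hsplit U]
    field_simp [(hFRpos U).ne', hZBpos.ne', hZTpos.ne']
  have hπ' : (q.withDensity fun U => ENNReal.ofReal (ρ U)⁻¹) = π := withDensity_inv_density hρm hρpos hρq
  have hwm : Measurable fun U => (ρ U)⁻¹ := hρm.inv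
  have hw0' : ∀ U, 0 < (ρ U)⁻¹ := fun U => inv_pos.2 (hρpos U)
  have hwb : ∀ U, |(ρ U)⁻¹| ≤ ZB * M ^ k / ZT := by
    intro U
    rw [abs_of_pos (hw0' U), hρ, inv_div]
    exact div_le_div_of_nonneg_right (mul_le_mul_of_nonneg_left (hFRle U) hZBpos.le) hZTpos.le
  have hwi : Integrable (fun U => (ρ U)⁻¹) q := integrable_of_bounded q hwm hwb
  -- (a) the acceptance mass from `U` is at most `ρ(U)`
  have hone : ∫⁻ y, ENNReal.ofReal (ρ y)⁻¹ ∂q = 1 := by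
    have h : π Set.univ = 1 := measure_univ
    rw [← hπ', withDensity_apply _ MeasurableSet.univ, Measure.restrict_univ] at h
    exact h
  have hacc : ∀ U, (imhAcceptMass q (fun U => (ρ U)⁻¹) U).toReal ≤ ρ U := by
    intro U
    have h := imhAcceptMass_le (q := q) hw0' U
    rw [hone, mul_one, inv_inv] at h
    have h2 := ENNReal.toReal_mono ENNReal.ofReal_ne_top h
    rwa [ENNReal.toReal_ofReal (hρpos U).le] at h2
  refine ⟨fun U => (hacc U).trans (hρle U), ?_⟩
  -- (b) the `τ_int` floor of a frozen event
  intro θ hθ A hA hAθ hApos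
  have hηA : ∀ U ∈ A, (imhAcceptMass q (fun U => (ρ U)⁻¹) U).toReal ≤ η / θ := by
    intro U hU
    have h' : θ * M ^ k < FR U := hAθ U hU
    have hfr : M ^ k / FR U ≤ 1 / θ := by
      rw [div_le_div_iff₀ (hFRpos U) hθ, one_mul]; linarith
    refine (hacc U).trans ((hρle U).trans ?_)
    calc η * (M ^ k / FR U) ≤ η * (1 / θ) := mul_le_mul_of_nonneg_left hfr hη0
      _ = η / θ := mul_one_div _ _
  set g : GaugeConfig d L G → ℝ := fun U => A.indicator (fun _ => (1 : ℝ)) U - π.real A with hg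
  have hp1 : π.real A ≤ 1 := measureReal_le_one
  have hgm : Measurable g := (measurable_const.indicator hA).sub measurable_const
  have hgb : ∀ U, |g U| ≤ 1 := by
    intro U
    by_cases hU : U ∈ A
    · simp only [hg, Set.indicator_of_mem hU]
      rw [abs_le]; constructor <;> linarith [hApos.le, hp1]
    · simp only [hg, Set.indicator_of_notMem hU]
      rw [abs_le]; constructor <;> linarith [hApos.le, hp1]
  have hg0 : ∫ U, g U ∂π = 0 := by
    simp only [hg]
    rw [integral_sub ((integrable_const _).indicator hA) (integrable_const _),
      integral_indicator_const (1 : ℝ) hA, integral_const, smul_eq_mul, smul_eq_mul, mul_one,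
      probReal_univ, one_mul, sub_self]
  have hcov := (plaquetteBlockProposal_autocorrelation (G := G) hw hm0 hm hM B π q hπ hq hgm hgb hg0).1
  -- summability of the autocorrelation series (Doeblin envelope of the scorecard)
  have hsum : Summable fun n => autocov (indepMH q fun U => (ρ U)⁻¹) π g (n + 1) /
      autocov (indepMH q fun U => (ρ U)⁻¹) π g 0 := by
    by_cases hz : autocov (indepMH q fun U => (ρ U)⁻¹) π g 0 = 0
    · simp only [hz, div_zero]; exact summable_zero
    · have hC0 : 0 < autocov (indepMH q fun U => (ρ U)⁻¹) π g 0 := by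
        rw [autocov_zero] at hz ⊢
        exact lt_of_le_of_ne (integral_nonneg fun U => sq_nonneg _) (Ne.symm hz)
      have hr0 : 0 ≤ 1 - (m / M) ^ k := by
        have : (m / M) ^ k ≤ 1 := pow_le_one₀ (div_nonneg hm0.le hMpos.le)
          ((div_le_one hMpos).2 (by linarith [hm 1, hM 1]))
        linarith
      have hr1 : 1 - (m / M) ^ k < 1 := by
        have : 0 < (m / M) ^ k := pow_pos (div_pos hm0 hMpos) _
        linarith
      refine Summable.of_norm_bounded ((summable_geometric_of_lt_one hr0 hr1).mul_left (1 - (m / M) ^ k))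
        fun n => ?_
      rw [Real.norm_eq_abs, abs_div, abs_of_pos hC0, div_le_iff₀ hC0]
      have h := hcov (n + 1)
      rw [← autocov_zero] at h
      calc |autocov (indepMH q fun U => (ρ U)⁻¹) π g (n + 1)|
          ≤ (1 - (m / M) ^ k) ^ (n + 1) * autocov (indepMH q fun U => (ρ U)⁻¹) π g 0 := h
        _ = (1 - (m / M) ^ k) * (1 - (m / M) ^ k) ^ n *
              autocov (indepMH q fun U => (ρ U)⁻¹) π g 0 := by ring
  exact indepMH_event_tauInt_ge hwm hw0' hwi hπ' hA (div_nonneg hη0 hθ.le) hηA hApos hsum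

end Floor

end Summit.Ventures.LatticeQCDFlow.Theory2.Autoregressive

end
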